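import Literature.NumberTheory.EllipticCurves.SemilinearTateDualPlaces
import Summits.BirchSwinnertonDyer.BirchSwinnertonDyer.Theorems.Rank1ResidualJetConjActSelmer
import Literature.NumberTheory.GaloisCohomology.PoitouTateSelmerStructures
import HarnessLib

/-!
# T1 JET (cell `bsd-jet`), road K, stub S1 (dual side): `σ_*`-stability of dual Selmer groups and dual
# local conditions on `E[n]^D`, the Y-side transport data, and the involutivity of `conjActDual`

HONEST FRAMING (programme file `BSD-LIT2PART-PROGRAMME-v1.md` §HONESTY, verbatim): «no tranche here
proves BSD; ARM L moves the LITERAL column of an r ≤ 1 census into the kernel-proved-modulo-named-print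
column; ARM P changes what «named print» is worth.» THEOREMS ONLY (seat `bsd-jet-pv-1`, session g4;
`--supports stmt-BirchSwinnertonDyer-14418`, helper): no definition, no named fact, no `sorry`.
Nothing is booked; 0 classes move.

## What (dual-side twin of `Rank1ResidualJetConjActSelmer.lean`, over `SemilinearTateDualPlaces.lean`)

* `exists_sq_eq_smul`, `semilinearH_one_semilinearH_one` (generic: for `σ² = 1` the global semilinear
  action in degree `1` is an involution when `ψ ∘ ψ = ρ(τ²)` — inner pairs act trivially);
* `conjActDual_mem_selmerGroup_of_transport` — the Selmer group of a `σ`-stable Selmer structure on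
  `E[n]^D = Hom(E[n], μ_N)` is `conjActDual`-stable (`conjActPlaceDual_localization`);
* `conjActPlaceDual_mem_dualLocalCondition` — `σ_*` carries the dual local condition `𝓕_v^*` into
  `𝓕_{σv}^*` for a `σ`-stable `𝓕` and a conjugation-compatible family `inv`
  (`localTatePairingZMod_conjActPlace` + round trip);
* `exists_piTransport_conjActPlaceDual` — the Y-side transport data `(π, eY, τ_Y)` with round trip,
  identification and `loc'_T`-equivariance for `c' = conjActDual` (inputs of
  `Rank1ResidualJetPairingCountingPermutation`);
* `conjActDual_conjActDual` — `conjActDual` is an involution for `σ² = 1`.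

References (locators only; no cited FACT is declared): [cite: Jetchev2008, §5 Thm. 5.1 (p. 822), §6.2]
[cite: Howard2004HeegnerKolyvagin, Def. 2.1.6] [cite: SerreLocalFields1979, VII.§5 Prop. 3]
[cite: GrossLMS1991, §5 (5.1)]. Design: no definitions; universes `u` (for `K`), `v`.
Axioms: `propext`, `Classical.choice`, `Quot.sound`.
-/

set_option autoImplicit false

noncomputable section

open scoped Classical
open Function NumberField IsDedekindDomain WeierstrassCurve Field
open Literature.NumberTheory.EllipticCurves Literature.NumberTheory.GaloisRepresentations
open Literature.NumberTheory.GaloisCohomology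
open Literature.NumberTheory.GaloisRepresentations.DiscreteGaloisModule (localTatePairingZMod
  tateDual SelmerStructure)

universe u v

namespace Summit.BirchSwinnertonDyer.Rank1Residual.JET.GlobalDuality

/-! ### Round trip of the global dual action -/

section GlobalRoundTrip

variable {k : Type v} {K : Type u} [Field k] [Field K] [Algebra k K]
variable {M : Type u} [AddCommGroup M] [TopologicalSpace M] [DiscreteTopology M]
variable {ρ : DiscreteGaloisModule K M} {σ : K ≃ₐ[k] K} {τ : AlgebraicClosure K ≃+* AlgebraicClosure K}

/-- If `σ² = 1`, the square of a lift `τ` of `σ` is an element `γ ∈ Γ_K`: `τ (τ x) = γ • x`.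
[cite: GrossLMS1991, §5 (5.1)] -/
theorem exists_sq_eq_smul (hτ : IsLiftOfAut σ τ) (hσ : σ * σ = 1) :
    ∃ γ : absoluteGaloisGroup K, ∀ x, τ (τ x) = γ • x := by
  refine ⟨(absoluteGaloisGroup.toAlgEquiv K).symm
    { τ.trans τ with
      commutes' := fun x => by
        change τ (τ (algebraMap K (AlgebraicClosure K) x)) = algebraMap K (AlgebraicClosure K) x
        rw [hτ, hτ, ← AlgEquiv.mul_apply, hσ, AlgEquiv.one_apply] }, fun x => rfl⟩

/-- **Global round trip in degree one**: if `τ² = γ ∈ Γ_K` on `K̄` and `ψ ∘ ψ = ρ(γ)`, the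
semilinear action `semilinearH … ψ … 1` is an involution of `H¹(K, M)` — the composite pair is the
inner pair of `γ`, and `g ↦ γ f(γ⁻¹ g γ)` is `f` plus the coboundary of `f γ`.
[cite: SerreLocalFields1979, VII.§5 Prop. 3] -/
theorem semilinearH_one_semilinearH_one (hτ : IsLiftOfAut σ τ) {ψ : M →+ M}
    (hψ : IsSemilinear ρ hτ ψ) {γ : absoluteGaloisGroup K} (hγ : ∀ x, τ (τ x) = γ • x)
    (hψψ : ∀ m, ψ (ψ m) = ρ γ m) (c : galoisCohomology ρ 1) :
    semilinearH hτ ψ hψ 1 (semilinearH hτ ψ hψ 1 c) = c := by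
  obtain ⟨f, rfl⟩ := oneCocycleClass_surjective ρ.toTopRep c
  have h1 : semilinearH hτ ψ hψ 1 (oneCocycleClass _ f) =
      oneCocycleClass _ (contOneCocycles.pullback hτ.conjGalCMH (semilinearHom hτ ψ hψ) f) :=
    map_oneCocycleClass _ _ _ f
  rw [h1]
  have h2 : semilinearH hτ ψ hψ 1 (oneCocycleClass _
      (contOneCocycles.pullback hτ.conjGalCMH (semilinearHom hτ ψ hψ) f)) =
      oneCocycleClass _ (contOneCocycles.pullback hτ.conjGalCMH (semilinearHom hτ ψ hψ)
        (contOneCocycles.pullback hτ.conjGalCMH (semilinearHom hτ ψ hψ) f)) :=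
    map_oneCocycleClass _ _ _ _
  rw [h2]
  have hgal : ∀ g : absoluteGaloisGroup K,
      hτ.conjGalCMH (hτ.conjGalCMH g) = γ⁻¹ * (g * γ) := by
    intro g
    apply (MulAction.toPerm_injective (α := absoluteGaloisGroup K) (β := AlgebraicClosure K))
    ext y
    change hτ.conjGalCMH (hτ.conjGalCMH g) • y = (γ⁻¹ * (g * γ)) • y
    rw [mul_smul, mul_smul, ← hγ, eq_inv_smul_iff, ← hγ]
    change τ (τ (τ.symm (τ.symm ((show AlgebraicClosure K ≃ₐ[K] AlgebraicClosure K from g)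
      (τ (τ y)))))) = _
    rw [RingEquiv.apply_symm_apply, RingEquiv.apply_symm_apply]
    rfl
  suffices h : oneCocycleClass _ (contOneCocycles.pullback hτ.conjGalCMH (semilinearHom hτ ψ hψ)
      (contOneCocycles.pullback hτ.conjGalCMH (semilinearHom hτ ψ hψ) f) - f) = 0 by
    rwa [oneCocycleClass_sub, sub_eq_zero] at h
  refine (oneCocycleClass_eq_zero_iff _ _).mpr ⟨f.1 γ, fun g => ?_⟩
  rw [Submodule.coe_sub, ContinuousMap.sub_apply, contOneCocycles.pullback_apply,
    contOneCocycles.pullback_apply]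
  change ψ (ψ (f.1 (hτ.conjGalCMH (hτ.conjGalCMH g)))) - f.1 g = _
  rw [hψψ, hgal]
  change ρ.toTopRep.ρ γ (f.1 (γ⁻¹ * (g * γ))) - f.1 g = ρ.toTopRep.ρ g (f.1 γ) - f.1 γ
  rw [contOneCocycles.apply_smul_inv_mul, f.2 g γ]
  abel

end GlobalRoundTrip

section DualSide

variable {K : Type u} [Field K] [NumberField K] (W : WeierstrassCurve ℚ) (σ : K ≃ₐ[ℚ] K) (n : ℤ)
  (N : ℕ) [Finite (geomTorsion (W.baseChange K) n)]

/-- **The Selmer group of a `σ`-stable Selmer structure on `E[n]^D` is `conjActDual`-stable**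
(dual-side twin of `conjAct_mem_selmerGroup_of_transport`; `conjActPlaceDual_localization`).
[cite: Jetchev2008, §5 Thm. 5.1 and §6.2] -/
theorem conjActDual_mem_selmerGroup_of_transport
    (𝓖' : SelmerStructure (((W.baseChange K).torsionGaloisModule n).tateDual N))
    (hfin : ∀ (v w : HeightOneSpectrum (𝓞 K)) (h : σ • v = w)
      (y : galoisCohomology ((((W.baseChange K).torsionGaloisModule n).tateDual N).toLocal
        (Sum.inr v : Place K)) 1), y ∈ 𝓖' (Sum.inr v) → conjActPlaceDual W σ n N h y ∈ 𝓖' (Sum.inr w))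
    (hinf : ∀ w : InfinitePlace K, 𝓖' (Sum.inl w) = ⊤)
    {y : galoisCohomology (((W.baseChange K).torsionGaloisModule n).tateDual N) 1}
    (hy : y ∈ 𝓖'.selmerGroup) : conjActDual W σ n N y ∈ 𝓖'.selmerGroup := by
  have hy' := (SelmerStructure.mem_selmerGroup_iff 𝓖' y).mp hy
  refine (SelmerStructure.mem_selmerGroup_iff 𝓖' _).mpr ?_
  rintro (w | w')
  · rw [hinf]; trivial
  · have h : σ • (σ⁻¹ • w') = w' := smul_inv_smul σ w'
    rw [← conjActPlaceDual_localization W σ n N h y]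
    exact hfin _ _ h _ (hy' _)

/-- **`σ_*` carries the dual local condition `𝓕_v^*` into `𝓕_{σv}^*`** for a `σ`-stable `𝓕` (stable
in both directions, `σ² = 1`) and a conjugation-compatible family `inv`: for `a ∈ 𝓕_{σv}` write
`a = σ_* a₀` with `a₀ = σ_* a ∈ 𝓕_v` (round trip), then `⟨a, σ_* y⟩_{σv} = ⟨a₀, y⟩_v = 0`
(`localTatePairingZMod_conjActPlace`). [cite: Jetchev2008, §5 Thm. 5.1]
[cite: Howard2004HeegnerKolyvagin, Def. 2.1.6] -/
theorem conjActPlaceDual_mem_dualLocalCondition (hσ : σ * σ = 1) (inv : LocalInvariants K N)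
    (hinv : inv.IsConjCompatible σ)
    (𝓕 : SelmerStructure ((W.baseChange K).torsionGaloisModule n))
    (h𝓕 : ∀ (v w : HeightOneSpectrum (𝓞 K)) (h : σ • v = w)
      (x : galoisCohomology (((W.baseChange K).torsionGaloisModule n).toLocal (Sum.inr v : Place K)) 1),
      x ∈ 𝓕 (Sum.inr v) → conjActPlace W σ n h x ∈ 𝓕 (Sum.inr w))
    {v w : HeightOneSpectrum (𝓞 K)} (h : σ • v = w)
    {y : galoisCohomology ((((W.baseChange K).torsionGaloisModule n).tateDual N).toLocal
      (Sum.inr v : Place K)) 1}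
    (hy : y ∈ inv.dualLocalCondition ((W.baseChange K).torsionGaloisModule n) (Sum.inr v : Place K)
      (𝓕 (Sum.inr v))) :
    conjActPlaceDual W σ n N h y ∈ inv.dualLocalCondition ((W.baseChange K).torsionGaloisModule n)
      (Sum.inr w : Place K) (𝓕 (Sum.inr w)) := by
  have h' : σ • w = v := by rw [← h, ← mul_smul, hσ, one_smul]
  rw [LocalInvariants.mem_dualLocalCondition_iff] at hy ⊢
  intro a ha
  have ha₀ : conjActPlace W σ n h' a ∈ 𝓕 (Sum.inr v) := h𝓕 _ _ h' a ha
  rw [← conjActPlace_conjActPlace W σ n hσ h' h a, localTatePairingZMod_conjActPlace W σ n N inv hinv h]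
  exact hy _ ha₀

/-- **The Y-side transport data of the `±` counting, at the finite places, from `conjActPlaceDual`**
(twin of `exists_piTransport_conjActPlace`): place involution, transports `eY` (= `σ_*` on pairs
`σ • i = j`), induced `τ_Y`, with round trip, identification and `loc'_T`-equivariance for
`c' = conjActDual W σ n N`. [cite: Jetchev2008, §5 Thm. 5.1 (p. 822)] -/
theorem exists_piTransport_conjActPlaceDual (hσ : σ * σ = 1) (T : Finset (HeightOneSpectrum (𝓞 K)))
    (hT : ∀ t ∈ T, σ • t ∈ T) :
    ∃ (π : T → T)
      (eY : ∀ i j : T,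
        galoisCohomology ((((W.baseChange K).torsionGaloisModule n).tateDual N).toLocal
          (Sum.inr (i : HeightOneSpectrum (𝓞 K)) : Place K)) 1 →+
        galoisCohomology ((((W.baseChange K).torsionGaloisModule n).tateDual N).toLocal
          (Sum.inr (j : HeightOneSpectrum (𝓞 K)) : Place K)) 1)
      (τY : (∀ i : T, galoisCohomology ((((W.baseChange K).torsionGaloisModule n).tateDual N).toLocal
          (Sum.inr (i : HeightOneSpectrum (𝓞 K)) : Place K)) 1) →+
        ∀ i : T, galoisCohomology ((((W.baseChange K).torsionGaloisModule n).tateDual N).toLocal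
          (Sum.inr (i : HeightOneSpectrum (𝓞 K)) : Place K)) 1),
      Function.Involutive π ∧
      (∀ i : T, ((π i : T) : HeightOneSpectrum (𝓞 K)) = σ • (i : HeightOneSpectrum (𝓞 K))) ∧
      (∀ (i j : T) (h : σ • (i : HeightOneSpectrum (𝓞 K)) = j), eY i j = conjActPlaceDual W σ n N h) ∧
      (∀ y j, τY y j = eY (π j) j (y (π j))) ∧
      (∀ j y, eY (π j) j (eY j (π j) y) = y) ∧
      (∀ (j : T) (y : galoisCohomology (((W.baseChange K).torsionGaloisModule n).tateDual N) 1),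
        galoisCohomology.localization (((W.baseChange K).torsionGaloisModule n).tateDual N)
            (Sum.inr (j : HeightOneSpectrum (𝓞 K)) : Place K) 1 (conjActDual W σ n N y) =
          eY (π j) j (galoisCohomology.localization
            (((W.baseChange K).torsionGaloisModule n).tateDual N)
            (Sum.inr ((π j : T) : HeightOneSpectrum (𝓞 K)) : Place K) 1 y)) := by
  have hσσ : ∀ v : HeightOneSpectrum (𝓞 K), σ • σ • v = v := fun v => by
    rw [← mul_smul, hσ, one_smul]
  let π : T → T := fun t => ⟨σ • (t : HeightOneSpectrum (𝓞 K)), hT _ t.2⟩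
  let eY : ∀ i j : T,
      galoisCohomology ((((W.baseChange K).torsionGaloisModule n).tateDual N).toLocal
        (Sum.inr (i : HeightOneSpectrum (𝓞 K)) : Place K)) 1 →+
      galoisCohomology ((((W.baseChange K).torsionGaloisModule n).tateDual N).toLocal
        (Sum.inr (j : HeightOneSpectrum (𝓞 K)) : Place K)) 1 :=
    fun i j => if h : σ • (i : HeightOneSpectrum (𝓞 K)) = j then conjActPlaceDual W σ n N h else 0
  have heY : ∀ (i j : T) (h : σ • (i : HeightOneSpectrum (𝓞 K)) = j),
      eY i j = conjActPlaceDual W σ n N h := fun i j h => dif_pos h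
  obtain ⟨τY, hτY⟩ := piTransport_exists π eY
  refine ⟨π, eY, τY, fun i => Subtype.ext (hσσ i), fun _ => rfl, heY, hτY, fun j y => ?_,
    fun j y => ?_⟩
  · rw [heY j (π j) rfl, heY (π j) j (hσσ j)]
    exact conjActPlaceDual_conjActPlaceDual W σ n N hσ rfl (hσσ j) y
  · rw [heY (π j) j (hσσ j)]
    exact (conjActPlaceDual_localization W σ n N (hσσ j) y).symm

end DualSide

section DualInvolution

variable {K : Type u} [Field K] [NumberField K] (W : WeierstrassCurve ℚ) (σ : K ≃ₐ[ℚ] K) (n : ℤ)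
  (N : ℕ) [Finite (geomTorsion (W.baseChange K) n)]

/-- **`conjActDual` is an involution of `H¹(K, E[n]^D)` for `σ² = 1`** (`semilinearH_one_semilinearH_one`
with the composition laws of `τ` on `μ_N` and on points). [cite: GrossLMS1991, §5 (5.1)]
[cite: SerreLocalFields1979, VII.§5 Prop. 3] -/
theorem conjActDual_conjActDual (hσ : σ * σ = 1)
    (y : galoisCohomology (((W.baseChange K).torsionGaloisModule n).tateDual N) 1) :
    conjActDual W σ n N (conjActDual W σ n N y) = y := by
  obtain ⟨γ, hγ⟩ := exists_sq_eq_smul (isLiftOfAut_liftAut σ) hσ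
  refine semilinearH_one_semilinearH_one (isLiftOfAut_liftAut σ) _ hγ (fun f => ?_) y
  exact tateDualSemilinearMap_comp (ρ := (W.baseChange K).torsionGaloisModule n)
    (muSemilinearMap_comp N hγ)
    (inv_comp_inv_eq_of_comp_eq (ρ := (W.baseChange K).torsionGaloisModule n)
      ((isLiftOfAut_liftAut σ).torsionMap_symm_apply W n)
      ((isLiftOfAut_liftAut σ).torsionMap_symm_apply W n)
      ((isLiftOfAut_liftAut σ).torsionMap_comp_eq_apply W (isLiftOfAut_liftAut σ) n γ hγ)) f

end DualInvolution

end Summit.BirchSwinnertonDyer.Rank1Residual.JET.GlobalDuality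

end
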